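/-
Copyright: the b2b-balaban T⁴-continuum CRUX team, row NE7b OWNER lineage `t4-ne7b-p1` (gen 105). Project licence.
-/
import Mathlib.Analysis.Matrix.Spectrum
import Mathlib.Analysis.Matrix.PosDef

/-!
# Simultaneous diagonalisation of a positive-definite and a positive-semidefinite real quadratic form,
# with the DOMINATION and RANK bookkeeping that the Gaussian domination lemma of row NE7b consumes

Cell `pub-balaban`, sub-cell `t4`, spine estimate NE7b (`T4WeightBudget.RelWeightBound`; the cell's OWN estimate — NOT PRINTED
in [Bałaban 1983–89], NOT PROVED).  Crux-route work under `Spine/NE7b/`; pure finite-dimensional linear algebra over `ℝ`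
(Mathlib's spectral theorem for real symmetric matrices, twice); NOTHING of Bałaban's is named or asserted; zero `sorry`.

WHY.  The re-cut road's one residual lemma of Bałaban's kind is `LocalConditionalStability.LocCondStability` — a conditional
exponential-moment bound `∫ M·e dμ ≤ e^{b}·∫ e dμ` with `b = O(1)·|Z|` UNIFORMLY in the running coupling.  Print's BY-VALUE
mechanism for it is [Balaban1989LargeFieldII] p. 383 l. 21–28: «The integrals with respect to the fields A_j … are estimated
using the positivity properties of the quadratic forms, and we get the factors exp O(1)|Z_j ∩ Ω_j|».  In finite dimensions that
sentence is the GAUSSIAN DOMINATION LEMMA (`…NE7b.GaussianDominatedMoment`): for a positive-definite form `S` and a positive-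
semidefinite form `Q` with `Q ≤ δ·S` (`δ < 1`) and `rank Q ≤ r`, `∫ e^{Q} e^{−S} ≤ (1 − δ)^{−r/2} ∫ e^{−S}`.  Its proof is a
change of variables to coordinates in which `S` is the unit form and `Q` is diagonal; THIS FILE supplies those coordinates with
the three pieces of bookkeeping the bound needs: the diagonal entries lie in `[0, δ]`, and the number of non-zero ones IS the
rank of `Q` (so the cost is extensive in the number of DOMINATED DIRECTIONS — the volume `|Z|` — and not in the dimension).

WHAT IS PROVED ([folklore]):
* §1 the form `x ⬝ᵥ M *ᵥ x` (written out, no new definition): `qf_mulVec` (`(A y)ᵀ M (A y) = yᵀ (Aᵀ M A) y`), `qf_one`,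
  `qf_diagonal`, `qf_sub`, `qf_smul`, `qf_nonneg_of_posSemidef`, `qf_le_of_dominated`.
* §2 `det_ne_zero_of_star_mul_self`, `posSemidef_transpose_mul_mul` (congruence preserves `PosSemidef` over `ℝ`),
  `diag_nonneg_of_posSemidef`.
* §3 **`exists_transpose_mul_self_eq_one_and_diagonal`**: for `S` positive definite and `Q` positive semidefinite there is an
  invertible `A` with `Aᵀ S A = 1` and `Aᵀ Q A = diagonal d` (spectral theorem for `S`, rescaling by `λ^{−1/2}`, spectral
  theorem for the congruent image of `Q`).
* §4 **`exists_simDiag_dominated`**: the same in quadratic-form currency with the bookkeeping — `(A x)ᵀ S (A x) = Σ xᵢ²`,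
  `(A x)ᵀ Q (A x) = Σ dᵢ xᵢ²`, `0 ≤ dᵢ`, `dᵢ ≤ δ` whenever `δ·S − Q` is positive semidefinite, and `#{i : dᵢ ≠ 0} = rank Q`.

NOT HERE (honest): any measure or integral (the Gaussian lemma is the next file); anything of Bałaban's.  NE7b NOT PRINTED ∕
NOT PROVED; spine PROVED 0∕9; rung (B)+1 on a FINITE torus — NOT infinite volume, NOT the mass gap, NOT Clay.
HONEST DEPENDENCY: continuum YM on T⁴ ⇐ BetaPertH ∧ nine spine estimates (0/9 proved); BetaPertH ⇐ (D1) ∧ (D4) ∧ CAP+tail.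
-/

set_option autoImplicit false

open Matrix Finset

namespace Summit.QuantumFields.BalabanUV.T4Continuum.NE7b.QuadFormSimDiag

variable {n : Type*} [Fintype n] [DecidableEq n]

/-! ## §1 Quadratic forms `x ⬝ᵥ M *ᵥ x` of real square matrices (no new definition: the form is written out) -/

omit [DecidableEq n] in
/-- Change of variables in a quadratic form: `(A y)ᵀ M (A y) = yᵀ (Aᵀ M A) y`. [folklore] -/
theorem qf_mulVec (M A : Matrix n n ℝ) (y : n → ℝ) :
    (A *ᵥ y) ⬝ᵥ (M *ᵥ (A *ᵥ y)) = y ⬝ᵥ ((Aᵀ * M * A) *ᵥ y) := by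
  rw [Matrix.mul_assoc, ← mulVec_mulVec, ← mulVec_mulVec, dotProduct_mulVec y Aᵀ, vecMul_transpose]

/-- The unit form is the sum of squares. [folklore] -/
theorem qf_one (x : n → ℝ) : x ⬝ᵥ ((1 : Matrix n n ℝ) *ᵥ x) = ∑ i, x i ^ 2 := by
  simp only [one_mulVec, dotProduct, sq]

/-- A diagonal form is a weighted sum of squares. [folklore] -/
theorem qf_diagonal (d x : n → ℝ) : x ⬝ᵥ (diagonal d *ᵥ x) = ∑ i, d i * x i ^ 2 := by
  simp only [dotProduct, mulVec_diagonal, sq]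
  exact Finset.sum_congr rfl fun i _ => by ring

omit [DecidableEq n] in
/-- The form is subtractive in the matrix. [folklore] -/
theorem qf_sub (M N : Matrix n n ℝ) (x : n → ℝ) :
    x ⬝ᵥ ((M - N) *ᵥ x) = x ⬝ᵥ (M *ᵥ x) - x ⬝ᵥ (N *ᵥ x) := by
  simp only [sub_mulVec, dotProduct_sub]

omit [DecidableEq n] in
/-- The form is homogeneous in the matrix. [folklore] -/
theorem qf_smul (c : ℝ) (M : Matrix n n ℝ) (x : n → ℝ) : x ⬝ᵥ ((c • M) *ᵥ x) = c * (x ⬝ᵥ (M *ᵥ x)) := by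
  simp only [smul_mulVec, dotProduct_smul, smul_eq_mul]

omit [DecidableEq n] in
/-- A positive-semidefinite real matrix has a non-negative quadratic form. [folklore] -/
theorem qf_nonneg_of_posSemidef {M : Matrix n n ℝ} (hM : M.PosSemidef) (x : n → ℝ) : 0 ≤ x ⬝ᵥ (M *ᵥ x) := by
  simpa using hM.dotProduct_mulVec_nonneg x

omit [DecidableEq n] in
/-- `Q ≤ δ S` in the Loewner order gives the pointwise domination of the forms. [folklore] -/
theorem qf_le_of_dominated {S Q : Matrix n n ℝ} {δ : ℝ} (hdom : (δ • S - Q).PosSemidef) (x : n → ℝ) :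
    x ⬝ᵥ (Q *ᵥ x) ≤ δ * (x ⬝ᵥ (S *ᵥ x)) := by
  have h := qf_nonneg_of_posSemidef hdom x
  rw [qf_sub, qf_smul] at h
  linarith

/-! ## §2 Small matrix facts over `ℝ` -/

omit [Fintype n] [DecidableEq n] in
/-- Over `ℝ`, `star` of a matrix is its transpose. [folklore] -/
theorem star_eq_transpose (M : Matrix n n ℝ) : star M = Mᵀ := by
  rw [star_eq_conjTranspose, conjTranspose_eq_transpose_of_trivial]

/-- A matrix with `star U * U = 1` has non-zero determinant. [folklore] -/
theorem det_ne_zero_of_star_mul_self {U : Matrix n n ℝ} (hU : star U * U = 1) : U.det ≠ 0 := by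
  have h := congrArg Matrix.det hU
  rw [det_mul, det_one] at h
  intro h0
  rw [h0, mul_zero] at h
  exact zero_ne_one h

omit [DecidableEq n] in
/-- Congruence by a real matrix preserves positive semidefiniteness: `Aᵀ P A` is positive semidefinite. [folklore] -/
theorem posSemidef_transpose_mul_mul {P : Matrix n n ℝ} (hP : P.PosSemidef) (A : Matrix n n ℝ) :
    (Aᵀ * P * A).PosSemidef := by
  have h := hP.conjTranspose_mul_mul_same A
  rwa [conjTranspose_eq_transpose_of_trivial] at h

omit [Fintype n] [DecidableEq n] in
/-- Diagonal entries of a positive-semidefinite real matrix are non-negative. [folklore] -/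
theorem diag_nonneg_of_posSemidef {P : Matrix n n ℝ} (hP : P.PosSemidef) (i : n) : 0 ≤ P i i :=
  hP.diag_nonneg

/-! ## §3 Simultaneous diagonalisation -/

/-- **SIMULTANEOUS DIAGONALISATION** of a positive-definite `S` and a positive-semidefinite `Q` over `ℝ`: there is an
invertible `A` with `Aᵀ S A = 1` and `Aᵀ Q A` diagonal.  (Spectral theorem `S = U₁ Λ U₁ᵀ`, `B := U₁ Λ^{−1/2}` gives
`Bᵀ S B = 1`; spectral theorem for the symmetric `Bᵀ Q B = U₂ D U₂ᵀ`; `A := B U₂`.) [folklore] -/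
theorem exists_transpose_mul_self_eq_one_and_diagonal {S Q : Matrix n n ℝ} (hS : S.PosDef) (hQ : Q.PosSemidef) :
    ∃ A : Matrix n n ℝ, ∃ d : n → ℝ, A.det ≠ 0 ∧ Aᵀ * S * A = 1 ∧ Aᵀ * Q * A = diagonal d := by
  -- step 1: `S = U₁ Λ U₁ᵀ` with `Λ > 0`
  set U₁ : Matrix n n ℝ := (hS.1.eigenvectorUnitary : Matrix n n ℝ) with hU₁
  have hspecS : S = U₁ * diagonal hS.1.eigenvalues * star U₁ := by
    have h := hS.1.spectral_theorem
    rw [Unitary.conjStarAlgAut_apply] at h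
    simpa [RCLike.ofReal_real_eq_id] using h
  have hU₁u : star U₁ * U₁ = 1 := Matrix.mem_unitaryGroup_iff'.mp hS.1.eigenvectorUnitary.2
  have hev : ∀ i, 0 < hS.1.eigenvalues i := hS.eigenvalues_pos
  -- the rescaling `c i = λ_i^{−1/2}`
  set c : n → ℝ := fun i => (Real.sqrt (hS.1.eigenvalues i))⁻¹ with hc
  have hcev : ∀ i, c i * hS.1.eigenvalues i * c i = 1 := by
    intro i
    have hs : Real.sqrt (hS.1.eigenvalues i) ^ 2 = hS.1.eigenvalues i := Real.sq_sqrt (hev i).le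
    have hne : Real.sqrt (hS.1.eigenvalues i) ≠ 0 := (Real.sqrt_pos.2 (hev i)).ne'
    simp only [hc]
    field_simp
    rw [hs]
  have hc0 : ∀ i, c i ≠ 0 := fun i => inv_ne_zero (Real.sqrt_pos.2 (hev i)).ne'
  set B : Matrix n n ℝ := U₁ * diagonal c with hB
  have hBt : Bᵀ = diagonal c * star U₁ := by
    rw [hB, transpose_mul, diagonal_transpose, star_eq_transpose]
  have hBSB : Bᵀ * S * B = 1 := by
    rw [hBt, hspecS, hB]
    calc diagonal c * star U₁ * (U₁ * diagonal hS.1.eigenvalues * star U₁) * (U₁ * diagonal c)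
        = diagonal c * (star U₁ * U₁) * diagonal hS.1.eigenvalues * ((star U₁ * U₁) * diagonal c) := by
          simp only [Matrix.mul_assoc]
      _ = diagonal fun i => c i * hS.1.eigenvalues i * c i := by
          rw [hU₁u, Matrix.mul_one, Matrix.one_mul, diagonal_mul_diagonal, diagonal_mul_diagonal]
      _ = 1 := by
          rw [← diagonal_one]
          exact congrArg diagonal (funext hcev)
  have hBdet : B.det ≠ 0 := by
    rw [hB, det_mul, det_diagonal]
    exact mul_ne_zero (det_ne_zero_of_star_mul_self hU₁u) (Finset.prod_ne_zero_iff.2 fun i _ => hc0 i)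
  -- step 2: diagonalise the congruent image `M = Bᵀ Q B`
  set M : Matrix n n ℝ := Bᵀ * Q * B with hM
  have hMpsd : M.PosSemidef := posSemidef_transpose_mul_mul hQ B
  set U₂ : Matrix n n ℝ := (hMpsd.1.eigenvectorUnitary : Matrix n n ℝ) with hU₂
  have hspecM : M = U₂ * diagonal hMpsd.1.eigenvalues * star U₂ := by
    have h := hMpsd.1.spectral_theorem
    rw [Unitary.conjStarAlgAut_apply] at h
    simpa [RCLike.ofReal_real_eq_id] using h
  have hU₂u : star U₂ * U₂ = 1 := Matrix.mem_unitaryGroup_iff'.mp hMpsd.1.eigenvectorUnitary.2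
  -- step 3: `A = B U₂`
  refine ⟨B * U₂, hMpsd.1.eigenvalues, ?_, ?_, ?_⟩
  · rw [det_mul]
    exact mul_ne_zero hBdet (det_ne_zero_of_star_mul_self hU₂u)
  · rw [transpose_mul, ← star_eq_transpose U₂]
    calc star U₂ * Bᵀ * S * (B * U₂) = star U₂ * (Bᵀ * S * B) * U₂ := by simp only [Matrix.mul_assoc]
      _ = 1 := by rw [hBSB, Matrix.mul_one, hU₂u]
  · rw [transpose_mul, ← star_eq_transpose U₂]
    have h1 : star U₂ * Bᵀ * Q * (B * U₂) = star U₂ * M * U₂ := by simp only [hM, Matrix.mul_assoc]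
    have h2 : star U₂ * (U₂ * diagonal hMpsd.1.eigenvalues * star U₂) * U₂ = diagonal hMpsd.1.eigenvalues := by
      calc star U₂ * (U₂ * diagonal hMpsd.1.eigenvalues * star U₂) * U₂
          = (star U₂ * U₂) * diagonal hMpsd.1.eigenvalues * (star U₂ * U₂) := by simp only [Matrix.mul_assoc]
        _ = diagonal hMpsd.1.eigenvalues := by rw [hU₂u, Matrix.one_mul, Matrix.mul_one]
    rw [← hspecM] at h2
    rw [h1]
    exact h2

/-! ## §4 The same with the domination ∕ rank bookkeeping, in quadratic-form currency -/

/-- The number of non-zero diagonal entries of `Aᵀ Q A = diagonal d` (`A` invertible) is the rank of `Q`. [folklore] -/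
theorem card_ne_zero_eq_rank {Q A : Matrix n n ℝ} {d : n → ℝ} (hA : A.det ≠ 0) (hd : Aᵀ * Q * A = diagonal d) :
    Fintype.card {i // d i ≠ 0} = Q.rank := by
  classical
  have hAu : IsUnit A.det := isUnit_iff_ne_zero.2 hA
  have hAtu : IsUnit Aᵀ.det := by rw [det_transpose]; exact hAu
  rw [← rank_diagonal d, ← hd, rank_mul_eq_left_of_isUnit_det A (Aᵀ * Q) hAu,
    rank_mul_eq_right_of_isUnit_det Aᵀ Q hAtu]

/-- **SIMULTANEOUS DIAGONALISATION WITH THE DOMINATION AND RANK BOOKKEEPING.**  For `S` positive definite, `Q` positive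
semidefinite and `δ·S − Q` positive semidefinite (`Q ≤ δ S` in the Loewner order) there are an invertible matrix `A` and
diagonal entries `d` with: `(A x)ᵀ S (A x) = Σ xᵢ²`, `(A x)ᵀ Q (A x) = Σ dᵢ xᵢ²`, `0 ≤ dᵢ ≤ δ`, and `#{i : dᵢ ≠ 0} = rank Q`.
[folklore] -/
theorem exists_simDiag_dominated {S Q : Matrix n n ℝ} {δ : ℝ} (hS : S.PosDef) (hQ : Q.PosSemidef)
    (hdom : (δ • S - Q).PosSemidef) :
    ∃ A : Matrix n n ℝ, ∃ d : n → ℝ, A.det ≠ 0 ∧ (∀ x, (A *ᵥ x) ⬝ᵥ (S *ᵥ (A *ᵥ x)) = ∑ i, x i ^ 2) ∧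
      (∀ x, (A *ᵥ x) ⬝ᵥ (Q *ᵥ (A *ᵥ x)) = ∑ i, d i * x i ^ 2) ∧ (∀ i, 0 ≤ d i) ∧ (∀ i, d i ≤ δ) ∧
      Fintype.card {i // d i ≠ 0} = Q.rank := by
  obtain ⟨A, d, hA, hSA, hQA⟩ := exists_transpose_mul_self_eq_one_and_diagonal hS hQ
  refine ⟨A, d, hA, fun x => ?_, fun x => ?_, fun i => ?_, fun i => ?_, card_ne_zero_eq_rank hA hQA⟩
  · rw [qf_mulVec, hSA, qf_one]
  · rw [qf_mulVec, hQA, qf_diagonal]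
  · -- `Aᵀ Q A = diagonal d` is positive semidefinite
    have h := diag_nonneg_of_posSemidef (posSemidef_transpose_mul_mul hQ A) i
    rwa [hQA, diagonal_apply_eq] at h
  · -- `Aᵀ (δS − Q) A = δ·1 − diagonal d` is positive semidefinite
    have h := diag_nonneg_of_posSemidef (posSemidef_transpose_mul_mul hdom A) i
    have e : Aᵀ * (δ • S - Q) * A = δ • (1 : Matrix n n ℝ) - diagonal d := by
      rw [Matrix.mul_sub, Matrix.sub_mul, Matrix.mul_smul, Matrix.smul_mul, hSA, hQA]
    rw [e, Matrix.sub_apply, Matrix.smul_apply, one_apply_eq, diagonal_apply_eq, smul_eq_mul, mul_one] at h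
    linarith

end Summit.QuantumFields.BalabanUV.T4Continuum.NE7b.QuadFormSimDiag
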